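import Literature.NumberTheory.GaloisRepresentations.UnramifiedKummer
import Mathlib.LinearAlgebra.LinearIndependent.Basic
import HarnessLib

/-!
# A unit-trace element for a finite quotient of a closed subgroup of `Γ_F` that is «unramified»
# (its inertia lies in the open subgroup)

Let `F` be a non-archimedean local field, `Γ_F = Gal(F̄/F)`, `I_F ≤ Γ_F` the inertia group
(`absInertia F`), `‖·‖ = algNorm F` the absolute value of `F̄`.  For a COMPACT subgroup
`G ≤ Γ_F` (fixed field `L = F̄^G`, an algebraic extension of `F`, in general of infinite degree)
and an OPEN subgroup `O ≤ Γ_F` with `[G : G ∩ O] < ∞` (the finite extension `L' = F̄^{G ∩ O}` of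
`L`) such that `G ∩ I_F ≤ O` («`L'/L` is unramified»: the inertia of `L` dies in `Gal(L'/L)`), we
construct `x ∈ F̄` with `‖x‖ ≤ 1`, fixed by `G ∩ O`, whose orbit sum over `G/(G ∩ O)` — the trace
`Tr_{L'/L} x` — is EXACTLY `1`:

* `exists_smul_eq_of_algNorm_le_one_of_sum_smul_eq_one`.

This is the classical fact that the trace of an unramified extension is surjective on integers
(Serre, *Local Fields*, Ch. V §1 and Ch. III §5 for finite extensions of local fields), in the
form needed by successive-approximation arguments over deeply ramified / unramified towers
(Coates–Greenberg 1996 §3; the tree's `AlmostEtale.exists_forall_eq_sub_of_cocycle_of_trace` takes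
exactly such an `x`).  The proof avoids residue-field Galois theory: by compactness and
`mem_absInertia_iff_smul_rootsOfUnity` (`I_F` is the fixator of the roots of unity of order prime to
`p`) some finite level `μ_N` already separates `G/(G ∩ O)`; Dedekind's independence of the
characters `ζ ↦ (g ζ mod 𝔓)` of `μ_N` (distinct because roots of unity of order prime to `p` are
distinct modulo `𝔓`) produces `η ∈ μ_N` whose orbit sum `S` over `G/Stab_G(ζ_N)` is a UNIT; then
`S⁻¹ η` has orbit sum exactly `1`, and summing it over `(G ∩ O)/Stab_G(ζ_N)` descends to `G ∩ O`.

THEOREMS ONLY (no definition, no instance, no named fact).  Consumer: the frame-restricted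
discharge of Greenberg's Prop. 2.4 (LNM 1716) for the anticyclotomic tower of an imaginary
quadratic field at a split prime (cell `pub/bsd-print-x9`, item stmt-BirchSwinnertonDyer-23237).

References: J.-P. Serre, *Local Fields*, GTM 67 (1979), Ch. III §5, Ch. IV §4 Prop. 16 and
Cor. 2, Ch. V §1 [SerreLocalFields1979]; J. Coates, R. Greenberg, *Kummer theory for abelian
varieties over local fields*, Invent. Math. 124 (1996), §2–§3 [CoatesGreenberg1996]; E. Artin,
*Galois Theory* (independence of characters).
-/

noncomputable section

open scoped Pointwise
open ValuativeRel Field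

namespace Literature.NumberTheory.GaloisRepresentations

open GaloisRepresentations.IsNonarchimedeanLocalField

variable {F : Type*} [Field F] [ValuativeRel F] [TopologicalSpace F] [IsNonarchimedeanLocalField F]

/-! ## §1 Roots of unity of order prime to `p`: norm one, injective reduction -/

/-- `residue 1 = 1`. [folklore] -/
private theorem residue_one : residue F (1 : AlgebraicClosure F) = 1 := by
  have h := residue_coe (F := F) (1 : absIntegers 𝒪[F] F)
  rwa [OneMemClass.coe_one, map_one] at h

/-- **Roots of unity of order prime to `p` are distinct modulo `𝔓`** (injectivity of reduction on
`μ_N`, `N` a unit of `𝒪[F]`): if `ζ₁ ^ N = ζ₂ ^ N = 1` and `ζ₁ ≡ ζ₂ (mod 𝔓)` then `ζ₁ = ζ₂`.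
[cite: SerreLocalFields1979, Ch. IV §4, proof of Prop. 16] -/
theorem eq_of_pow_eq_one_of_residue_eq {N : ℕ} (hNu : IsUnit ((N : ℕ) : 𝒪[F]))
    {ζ₁ ζ₂ : AlgebraicClosure F} (h₁ : ζ₁ ^ N = 1) (h₂ : ζ₂ ^ N = 1)
    (h : residue F ζ₁ = residue F ζ₂) : ζ₁ = ζ₂ := by
  have hN0 : N ≠ 0 := by rintro rfl; simp at hNu
  have hζ₂0 : ζ₂ ≠ 0 := by rintro rfl; rw [zero_pow hN0] at h₂; exact zero_ne_one h₂
  have hn₁ : algNorm F ζ₁ = 1 := algNorm_eq_one_of_pow_eq_one hN0 h₁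
  have hn₂ : algNorm F ζ₂ = 1 := algNorm_eq_one_of_pow_eq_one hN0 h₂
  have hlt : algNorm F (ζ₁ - ζ₂) < 1 := (residue_eq_residue_iff hn₁.le hn₂.le).mp h
  have hη : (ζ₁ / ζ₂) ^ N = 1 := by rw [div_pow, h₁, h₂, div_one]
  have hη1 : algNorm F (ζ₁ / ζ₂ - 1) < 1 := by
    have : ζ₁ / ζ₂ - 1 = (ζ₁ - ζ₂) / ζ₂ := by field_simp
    rw [this, algNorm_div, hn₂, div_one]
    exact hlt
  have := eq_one_of_pow_eq_one_of_algNorm_sub_one_lt_one hNu hη hη1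
  rwa [div_eq_one_iff_eq hζ₂0] at this

/-! ## §2 Compactness: a finite level of roots of unity separates `G / (G ∩ O)` -/

/-- **A finite level `μ_N` separates an unramified finite quotient.**  For `G ≤ Γ_F` compact, `O`
open and `G ∩ I_F ≤ O`: there is `N` prime to `p` (a unit of `𝒪[F]`) such that every `g ∈ G`
fixing all `N`-th roots of unity lies in `O`.  (`I_F = ⋂_N Fix(μ_N)` by
`mem_absInertia_iff_smul_rootsOfUnity`; the sets `(G ∖ O) ∩ Fix(μ_N)` are closed in the compact
`G ∖ O` with empty intersection.) [cite: SerreLocalFields1979, Ch. IV §4 Cor. 2 to Prop. 16] -/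
theorem exists_isUnit_forall_smul_eq_imp_mem (G : Subgroup (absoluteGaloisGroup F))
    (hGc : IsCompact (G : Set (absoluteGaloisGroup F))) (O : Subgroup (absoluteGaloisGroup F))
    (hO : IsOpen (O : Set (absoluteGaloisGroup F))) (hI : G ⊓ absInertia F ≤ O) :
    ∃ N : ℕ, IsUnit ((N : ℕ) : 𝒪[F]) ∧
      ∀ g ∈ G, (∀ ζ : AlgebraicClosure F, ζ ^ N = 1 → g • ζ = ζ) → g ∈ O := by
  classical
  -- index type: units `N`
  let ι := {N : ℕ // IsUnit ((N : ℕ) : 𝒪[F])}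
  let T : ι → Set (absoluteGaloisGroup F) :=
    fun N ↦ {σ | ∀ ζ : AlgebraicClosure F, ζ ^ (N : ℕ) = 1 → σ • ζ = ζ}
  have hT : ∀ N, IsClosed (T N) := by
    intro N
    have hTeq : T N = ⋂ ζ ∈ {ζ : AlgebraicClosure F | ζ ^ (N : ℕ) = 1},
        (MulAction.stabilizer (absoluteGaloisGroup F) ζ : Set (absoluteGaloisGroup F)) := by
      ext σ
      simp only [T, Set.mem_setOf_eq, Set.mem_iInter, SetLike.mem_coe, MulAction.mem_stabilizer_iff]
    rw [hTeq]
    refine isClosed_biInter fun ζ _ ↦ ?_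
    exact Subgroup.isClosed_of_isOpen _
      (stabilizer_isOpen_of_isIntegral (K := F) (L := AlgebraicClosure F) ζ)
  have hcpt : IsCompact ((G : Set (absoluteGaloisGroup F)) ∩ (O : Set (absoluteGaloisGroup F))ᶜ) :=
    hGc.inter_right hO.isClosed_compl
  have hempty : (G : Set (absoluteGaloisGroup F)) ∩ (O : Set (absoluteGaloisGroup F))ᶜ ∩
      ⋂ N, T N = ∅ := by
    ext σ
    simp only [Set.mem_inter_iff, SetLike.mem_coe, Set.mem_compl_iff, Set.mem_iInter,
      Set.mem_empty_iff_false, iff_false, not_and]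
    intro hσG hσT
    have hσI : σ ∈ absInertia F := by
      rw [mem_absInertia_iff_smul_rootsOfUnity]
      intro N hN ζ hζ
      exact hσT ⟨N, hN⟩ ζ hζ
    exact hσG.2 (hI (Subgroup.mem_inf.mpr ⟨hσG.1, hσI⟩))
  obtain ⟨u, hu⟩ := hcpt.elim_finite_subfamily_closed T hT hempty
  -- `N₀ = ∏_{N ∈ u} N`
  refine ⟨∏ N ∈ u, (N : ℕ), ?_, fun g hg hfix ↦ ?_⟩
  · rw [Nat.cast_prod]
    refine Finset.prod_induction _ (fun a ↦ IsUnit a) (fun a b ha hb ↦ ha.mul hb) isUnit_one ?_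
    intro N _
    exact N.2
  · by_contra hgO
    have hmem : g ∈ (G : Set (absoluteGaloisGroup F)) ∩ (O : Set (absoluteGaloisGroup F))ᶜ ∩
        ⋂ N ∈ u, T N := by
      refine ⟨⟨hg, hgO⟩, ?_⟩
      simp only [Set.mem_iInter]
      intro N hN ζ hζ
      apply hfix
      obtain ⟨c, hc⟩ := Finset.dvd_prod_of_mem (fun N : ι ↦ (N : ℕ)) hN
      rw [hc, pow_mul, hζ, one_pow]
    rw [hu] at hmem
    exact hmem

/-! ## §3 The unit-trace element over the stabiliser of `ζ_N` -/

omit [TopologicalSpace F] [IsNonarchimedeanLocalField F] in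
/-- `(N : F̄) ≠ 0` for `N` a unit of `𝒪[F]` (i.e. prime to `p`). [folklore] -/
private theorem natCast_algebraicClosure_ne_zero_of_isUnit {N : ℕ} (hNu : IsUnit ((N : ℕ) : 𝒪[F])) :
    ((N : ℕ) : AlgebraicClosure F) ≠ 0 := by
  intro h0
  have h1 : ((N : ℕ) : F) = 0 :=
    (algebraMap F (AlgebraicClosure F)).injective (by rw [map_natCast, map_zero]; exact h0)
  have h2 : ((N : ℕ) : 𝒪[F]) = 0 := by
    apply Subtype.ext
    push_cast
    exact h1
  rw [h2] at hNu
  exact not_isUnit_zero hNu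

omit [ValuativeRel F] [TopologicalSpace F] [IsNonarchimedeanLocalField F] in
/-- The stabiliser in `G` of a primitive `N`-th root of unity fixes every `N`-th root of unity.
[folklore] -/
private theorem smul_eq_self_of_mem_stabilizer_of_pow_eq_one (G : Subgroup (absoluteGaloisGroup F))
    {N : ℕ} (hN : N ≠ 0) {ζ : AlgebraicClosure F} (hζ : IsPrimitiveRoot ζ N)
    {h : G} (hh : h ∈ MulAction.stabilizer G ζ) {ξ : AlgebraicClosure F} (hξ : ξ ^ N = 1) :
    (h : absoluteGaloisGroup F) • ξ = ξ := by
  haveI : NeZero N := ⟨hN⟩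
  obtain ⟨i, -, rfl⟩ := hζ.eq_pow_of_pow_eq_one hξ
  have hh' : (h : absoluteGaloisGroup F) • ζ = ζ := hh
  rw [smul_pow', hh']

omit [ValuativeRel F] [TopologicalSpace F] [IsNonarchimedeanLocalField F] in
/-- The quotient of `G` by the stabiliser of a root of unity is finite (it is in bijection with
the orbit, a set of roots of unity). [folklore] -/
private theorem finite_quotient_stabilizer_of_isPrimitiveRoot (G : Subgroup (absoluteGaloisGroup F))
    {N : ℕ} (hN : N ≠ 0) {ζ : AlgebraicClosure F} (hζ : IsPrimitiveRoot ζ N) :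
    Finite (G ⧸ MulAction.stabilizer G ζ) := by
  classical
  have hfin : (MulAction.orbit G ζ).Finite := by
    refine Set.Finite.subset (Polynomial.nthRootsFinset N (1 : AlgebraicClosure F)).finite_toSet ?_
    rintro _ ⟨g, rfl⟩
    simp only [Finset.mem_coe, Polynomial.mem_nthRootsFinset (Nat.pos_of_ne_zero hN)]
    change ((g : absoluteGaloisGroup F) • ζ) ^ N = 1
    rw [← smul_pow', hζ.pow_eq_one, smul_one]
  haveI := hfin.to_subtype
  exact Finite.of_equiv _ (MulAction.orbitEquivQuotientStabilizer G ζ)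

/-- **Unit orbit sum over the stabiliser of `ζ_N`.**  For a subgroup `G ≤ Γ_F`, `N` prime to `p`
and `ζ` a primitive `N`-th root of unity, with `H = Stab_G(ζ)`: there is `x₀ ∈ F̄` of absolute
value `1`, fixed by `H`, whose orbit sum over `G/H` is exactly `1`.  (Dedekind independence of the
characters `μ_N → S/𝔓`, `m ↦ q m mod 𝔓`, which are pairwise distinct because roots of unity of
order prime to `p` are distinct mod `𝔓`, yields `η ∈ μ_N` whose orbit sum `S` is a unit; take
`x₀ = S⁻¹ η`.) [cite: SerreLocalFields1979, Ch. IV §4 Prop. 16 (proof) and Ch. V §1] -/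
theorem exists_sum_smul_eq_one_stabilizer (G : Subgroup (absoluteGaloisGroup F))
    {N : ℕ} (hNu : IsUnit ((N : ℕ) : 𝒪[F])) {ζ : AlgebraicClosure F} (hζ : IsPrimitiveRoot ζ N)
    [Fintype (G ⧸ MulAction.stabilizer G ζ)] :
    ∃ x₀ : AlgebraicClosure F, algNorm F x₀ = 1 ∧
      (∀ h ∈ MulAction.stabilizer G ζ, (h : absoluteGaloisGroup F) • x₀ = x₀) ∧
      (∑ q : G ⧸ MulAction.stabilizer G ζ, ((q.out : G) : absoluteGaloisGroup F) • x₀) = 1 := by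
  classical
  have hN0 : N ≠ 0 := by rintro rfl; simp at hNu
  have hHfix : ∀ h : G, h ∈ MulAction.stabilizer G ζ → ∀ ξ : AlgebraicClosure F, ξ ^ N = 1 →
      (h : absoluteGaloisGroup F) • ξ = ξ :=
    fun h hh ξ hξ ↦ smul_eq_self_of_mem_stabilizer_of_pow_eq_one G hN0 hζ hh hξ
  -- the `N`-th roots of unity as a monoid, their norms
  have hMpow : ∀ m : MonoidHom.mker (powMonoidHom N : AlgebraicClosure F →* AlgebraicClosure F),
      (m : AlgebraicClosure F) ^ N = 1 := fun m ↦ by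
    have := m.2; rwa [MonoidHom.mem_mker, powMonoidHom_apply] at this
  have hMnorm : ∀ (m : MonoidHom.mker (powMonoidHom N : AlgebraicClosure F →* AlgebraicClosure F))
      (σ : absoluteGaloisGroup F), algNorm F (σ • (m : AlgebraicClosure F)) = 1 :=
    fun m σ ↦ by rw [algNorm_smul]; exact algNorm_eq_one_of_pow_eq_one hN0 (hMpow m)
  -- the lifted function `q ↦ q • m` on `G / H` (well defined: `H` fixes `μ_N`)
  have hwd : ∀ (m : MonoidHom.mker (powMonoidHom N : AlgebraicClosure F →* AlgebraicClosure F)) (a b : G),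
      (QuotientGroup.leftRel (MulAction.stabilizer G ζ)) a b →
      ((a : absoluteGaloisGroup F) • (m : AlgebraicClosure F)) =
        (b : absoluteGaloisGroup F) • (m : AlgebraicClosure F) := by
    intro m a b hab
    rw [QuotientGroup.leftRel_apply] at hab
    have h := hHfix _ hab (m : AlgebraicClosure F) (hMpow m)
    rw [Subgroup.coe_mul, Subgroup.coe_inv, mul_smul, inv_smul_eq_iff] at h
    exact h.symm
  let φ : MonoidHom.mker (powMonoidHom N : AlgebraicClosure F →* AlgebraicClosure F) →
      G ⧸ MulAction.stabilizer G ζ → AlgebraicClosure F := fun m ↦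
    Quotient.lift (fun a : G ↦ (a : absoluteGaloisGroup F) • (m : AlgebraicClosure F)) (hwd m)
  have hφ : ∀ m (a : G), φ m (a : G ⧸ MulAction.stabilizer G ζ) =
      (a : absoluteGaloisGroup F) • (m : AlgebraicClosure F) := fun m a ↦ rfl
  have hφout : ∀ m (q : G ⧸ MulAction.stabilizer G ζ),
      φ m q = ((q.out : G) : absoluteGaloisGroup F) • (m : AlgebraicClosure F) := by
    intro m q
    rw [← hφ m q.out, QuotientGroup.out_eq']
  -- equivariance `g • φ m q = φ m (g • q)`
  have hφsmul : ∀ m (g : G) (q : G ⧸ MulAction.stabilizer G ζ),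
      (g : absoluteGaloisGroup F) • φ m q = φ m (g • q) := by
    intro m g q
    induction q using QuotientGroup.induction_on with
    | H a => rw [hφ, MulAction.Quotient.smul_mk, hφ, smul_eq_mul, Subgroup.coe_mul, mul_smul]
  -- the characters `f q : μ_N →* S/𝔓`, `m ↦ residue (q • m)`
  let f : G ⧸ MulAction.stabilizer G ζ →
      (MonoidHom.mker (powMonoidHom N : AlgebraicClosure F →* AlgebraicClosure F) →*
        absIntegers 𝒪[F] F ⧸ absMaximalIdeal F) := fun q ↦
    { toFun := fun m ↦ residue F (φ m q)
      map_one' := by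
        change residue F (φ 1 q) = 1
        rw [hφout, OneMemClass.coe_one, smul_one, residue_one]
      map_mul' := by
        intro m m'
        change residue F (φ (m * m') q) = residue F (φ m q) * residue F (φ m' q)
        rw [hφout, hφout, hφout, Submonoid.coe_mul, smul_mul',
          residue_mul (hMnorm m _).le (hMnorm m' _).le] }
  have hf : ∀ q m, f q m = residue F (φ m q) := fun _ _ ↦ rfl
  -- `ζ ∈ μ_N`
  have hζM : ζ ∈ MonoidHom.mker (powMonoidHom N : AlgebraicClosure F →* AlgebraicClosure F) := by
    rw [MonoidHom.mem_mker, powMonoidHom_apply]; exact hζ.pow_eq_one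
  -- injectivity of `f`
  have hfinj : Function.Injective f := by
    intro q q' hqq'
    induction q using QuotientGroup.induction_on with
    | H a =>
      induction q' using QuotientGroup.induction_on with
      | H b =>
        rw [QuotientGroup.eq, MulAction.mem_stabilizer_iff, Subgroup.smul_def,
          Subgroup.coe_mul, Subgroup.coe_inv, mul_smul, inv_smul_eq_iff]
        have h := DFunLike.congr_fun hqq' ⟨ζ, hζM⟩
        rw [hf, hf, hφ, hφ] at h
        exact (eq_of_pow_eq_one_of_residue_eq hNu
          (by rw [← smul_pow', hζ.pow_eq_one, smul_one])
          (by rw [← smul_pow', hζ.pow_eq_one, smul_one]) h).symm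
  -- Dedekind: some `η ∈ μ_N` has a unit orbit-sum residue
  obtain ⟨η, hη⟩ : ∃ η : MonoidHom.mker (powMonoidHom N : AlgebraicClosure F →* AlgebraicClosure F),
      ∑ q : G ⧸ MulAction.stabilizer G ζ, f q η ≠ 0 := by
    by_contra hall
    push Not at hall
    have hli := linearIndependent_monoidHom
      (MonoidHom.mker (powMonoidHom N : AlgebraicClosure F →* AlgebraicClosure F))
      (absIntegers 𝒪[F] F ⧸ absMaximalIdeal F)
    rw [linearIndependent_iff'] at hli
    have hsum : ∑ i ∈ (Finset.univ : Finset (G ⧸ MulAction.stabilizer G ζ)).image f,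
        (1 : absIntegers 𝒪[F] F ⧸ absMaximalIdeal F) • (i : _ → _) = 0 := by
      rw [Finset.sum_image (fun q _ q' _ h ↦ hfinj h)]
      ext m
      simp only [one_smul, Finset.sum_apply, Pi.zero_apply]
      exact hall m
    have h10 := hli _ (fun _ ↦ (1 : absIntegers 𝒪[F] F ⧸ absMaximalIdeal F)) hsum
      (f ((1 : G) : G ⧸ MulAction.stabilizer G ζ)) (Finset.mem_image_of_mem f (Finset.mem_univ _))
    exact one_ne_zero h10
  -- the orbit sum `S` of `η` over `G / H`: a `G`-invariant unit
  obtain ⟨S, hSdef⟩ : ∃ S : AlgebraicClosure F, S = ∑ q : G ⧸ MulAction.stabilizer G ζ, φ η q :=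
    ⟨_, rfl⟩
  have hSle : algNorm F S ≤ 1 := by
    rw [hSdef]
    exact algNorm_sum_le _ _ zero_le_one fun q _ ↦ by rw [hφout]; exact (hMnorm η _).le
  have hSres : residue F S ≠ 0 := by
    rw [hSdef, residue_sum _ _ fun q _ ↦ by rw [hφout]; exact (hMnorm η _).le]
    exact hη
  have hS1 : algNorm F S = 1 := by
    by_contra hne
    exact hSres ((residue_eq_zero_iff hSle).mpr (lt_of_le_of_ne hSle hne))
  have hS0 : S ≠ 0 := by
    intro h
    rw [h, show algNorm F (0 : AlgebraicClosure F) = 0 from algNorm_eq_zero_iff.mpr rfl] at hS1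
    exact zero_ne_one hS1
  have hSG : ∀ g : G, (g : absoluteGaloisGroup F) • S = S := by
    intro g
    rw [hSdef, Finset.smul_sum]
    simp_rw [hφsmul η g]
    exact Fintype.sum_equiv (MulAction.toPerm g) _ _ fun q ↦ rfl
  -- `x₀ = S⁻¹ η`
  refine ⟨S⁻¹ * (η : AlgebraicClosure F), ?_, ?_, ?_⟩
  · rw [algNorm_mul, algNorm_inv, hS1, inv_one, one_mul]
    have := hMnorm η 1; rwa [one_smul] at this
  · intro h hh
    rw [smul_mul', smul_inv'', hSG, hHfix h hh _ (hMpow η)]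
  · have hterm : ∀ q : G ⧸ MulAction.stabilizer G ζ,
        ((q.out : G) : absoluteGaloisGroup F) • (S⁻¹ * (η : AlgebraicClosure F)) = S⁻¹ * φ η q := by
      intro q
      rw [smul_mul', smul_inv'', hSG, hφout]
    simp_rw [hterm]
    rw [← Finset.mul_sum, ← hSdef, inv_mul_cancel₀ hS0]

/-! ## §4 Descent from `Stab_G(ζ_N)` to an intermediate subgroup -/

/-- **Descent of a unit-trace element.**  For subgroups `H ≤ K ≤ G` of finite index and `x₀` with
`‖x₀‖ ≤ 1`, fixed by `H`, whose orbit sum over `G/H` is `1`: the element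
`x = Σ_{b ∈ K/H} b • x₀` has `‖x‖ ≤ 1`, is fixed by `K`, and its orbit sum over `G/K` is `1`
(`G/H ≃ G/K × K/H`: transitivity of the trace `Tr_{L_H/L_G} = Tr_{L_K/L_G} ∘ Tr_{L_H/L_K}`).
[cite: SerreLocalFields1979, Ch. III §5 (trace in a tower) and Ch. V §1] -/
theorem exists_sum_smul_eq_one_of_le (G : Subgroup (absoluteGaloisGroup F)) {H K : Subgroup G}
    (hHK : H ≤ K) [Fintype (G ⧸ H)] [Fintype (G ⧸ K)] [Fintype (K ⧸ H.subgroupOf K)]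
    {x₀ : AlgebraicClosure F} (hx₀ : algNorm F x₀ ≤ 1)
    (hH : ∀ h ∈ H, (h : absoluteGaloisGroup F) • x₀ = x₀)
    (hsum : (∑ q : G ⧸ H, ((q.out : G) : absoluteGaloisGroup F) • x₀) = 1) :
    ∃ x : AlgebraicClosure F, algNorm F x ≤ 1 ∧
      (∀ k ∈ K, (k : absoluteGaloisGroup F) • x = x) ∧
      (∑ q : G ⧸ K, ((q.out : G) : absoluteGaloisGroup F) • x) = 1 := by
  classical
  -- `q ↦ q • x₀` on `G/H`
  have hwd₀ : ∀ a b : G, (QuotientGroup.leftRel H) a b →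
      (a : absoluteGaloisGroup F) • x₀ = (b : absoluteGaloisGroup F) • x₀ := by
    intro a b hab
    rw [QuotientGroup.leftRel_apply] at hab
    have h := hH _ hab
    rw [Subgroup.coe_mul, Subgroup.coe_inv, mul_smul, inv_smul_eq_iff] at h
    exact h.symm
  let ψ : G ⧸ H → AlgebraicClosure F :=
    Quotient.lift (fun a : G ↦ (a : absoluteGaloisGroup F) • x₀) hwd₀
  have hψ : ∀ a : G, ψ (a : G ⧸ H) = (a : absoluteGaloisGroup F) • x₀ := fun a ↦ rfl
  have hψout : ∀ q : G ⧸ H, ψ q = ((q.out : G) : absoluteGaloisGroup F) • x₀ := by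
    intro q
    rw [← hψ q.out, QuotientGroup.out_eq']
  have hψsum : ∑ q : G ⧸ H, ψ q = 1 := by simp_rw [hψout]; exact hsum
  -- `b ↦ b • x₀` on `K/H`
  have hwdK : ∀ a b : K, (QuotientGroup.leftRel (H.subgroupOf K)) a b →
      ((a : G) : absoluteGaloisGroup F) • x₀ = ((b : G) : absoluteGaloisGroup F) • x₀ := by
    intro a b hab
    rw [QuotientGroup.leftRel_apply, Subgroup.mem_subgroupOf] at hab
    have h := hH _ hab
    rw [Subgroup.coe_mul, Subgroup.coe_inv, Subgroup.coe_mul, Subgroup.coe_inv, mul_smul,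
      inv_smul_eq_iff] at h
    exact h.symm
  let ψK : K ⧸ H.subgroupOf K → AlgebraicClosure F :=
    Quotient.lift (fun a : K ↦ ((a : G) : absoluteGaloisGroup F) • x₀) hwdK
  have hψK : ∀ a : K, ψK (a : K ⧸ H.subgroupOf K) = ((a : G) : absoluteGaloisGroup F) • x₀ :=
    fun a ↦ rfl
  refine ⟨∑ b : K ⧸ H.subgroupOf K, ψK b, ?_, ?_, ?_⟩
  · -- `‖x‖ ≤ 1`
    refine algNorm_sum_le _ _ zero_le_one fun b _ ↦ ?_
    induction b using QuotientGroup.induction_on with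
    | H a => rw [hψK, algNorm_smul]; exact hx₀
  · -- fixed by `K`
    intro k hk
    rw [Finset.smul_sum]
    have hsm : ∀ b : K ⧸ H.subgroupOf K,
        (k : absoluteGaloisGroup F) • ψK b = ψK ((⟨k, hk⟩ : K) • b) := by
      intro b
      induction b using QuotientGroup.induction_on with
      | H a =>
        rw [hψK, MulAction.Quotient.smul_mk, hψK, smul_eq_mul, Subgroup.coe_mul, Subgroup.coe_mul,
          mul_smul]
    simp_rw [hsm]
    exact Fintype.sum_equiv (MulAction.toPerm (⟨k, hk⟩ : K)) _ _ fun b ↦ rfl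
  · -- orbit sum over `G/K`
    have hterm : ∀ (q : G ⧸ K) (b : K ⧸ H.subgroupOf K),
        ((q.out : G) : absoluteGaloisGroup F) • ψK b =
          ψ ((Subgroup.quotientEquivProdOfLE hHK).symm (q, b)) := by
      intro q b
      induction b using QuotientGroup.induction_on with
      | H a =>
        rw [hψK, ← mul_smul, ← Subgroup.coe_mul, Subgroup.quotientEquivProdOfLE_symm_apply,
          Quotient.map'_mk'']
        exact (hψ _).symm
    calc ∑ q : G ⧸ K, ((q.out : G) : absoluteGaloisGroup F) • ∑ b : K ⧸ H.subgroupOf K, ψK b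
        = ∑ q : G ⧸ K, ∑ b : K ⧸ H.subgroupOf K,
            ψ ((Subgroup.quotientEquivProdOfLE hHK).symm (q, b)) := by
          refine Finset.sum_congr rfl fun q _ ↦ ?_
          rw [Finset.smul_sum]
          exact Finset.sum_congr rfl fun b _ ↦ hterm q b
      _ = ∑ qb : (G ⧸ K) × (K ⧸ H.subgroupOf K),
            ψ ((Subgroup.quotientEquivProdOfLE hHK).symm qb) :=
          (Fintype.sum_prod_type' _).symm
      _ = ∑ a : G ⧸ H, ψ a :=
          Fintype.sum_equiv (Subgroup.quotientEquivProdOfLE hHK).symm _ _ fun _ ↦ rfl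
      _ = 1 := hψsum

/-! ## §5 The unit-trace element of an unramified finite quotient -/

/-- **Unit-trace element of an unramified finite quotient.**  Let `G ≤ Γ_F` be compact (fixed
field `L`), `O ≤ Γ_F` open with `[G : G ∩ O] < ∞` (the finite extension `L' = F̄^{G ∩ O}/L`),
and assume `G ∩ I_F ≤ O` (the inertia group of `L` acts trivially on `L'`, i.e. `L'/L` is
unramified).  Then there is `x ∈ F̄` with `‖x‖ ≤ 1`, fixed by `G ∩ O`, whose orbit sum over
coset representatives of `G/(G ∩ O)` — the trace `Tr_{L'/L}(x)` — equals `1`.  The form consumed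
by the tree's successive-approximation engine `AlmostEtale.exists_forall_eq_sub_of_cocycle_of_trace`
(there `0 < |Σ_q q.out • x|`; here the sum IS `1`).  Proof: §2 gives `N` prime to `p` with
`Stab_G(ζ_N) ≤ G ∩ O`, §3 the unit orbit sum over `G/Stab_G(ζ_N)`, §4 the descent.
[cite: SerreLocalFields1979, Ch. V §1 (trace of an unramified extension is surjective on integers); Ch. IV §4 Prop. 16, Cor. 2]
[cite: CoatesGreenberg1996, §3 (successive approximation over unramified/deeply ramified towers)] -/
theorem exists_smul_eq_of_algNorm_le_one_of_sum_smul_eq_one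
    (G : Subgroup (absoluteGaloisGroup F)) (hGc : IsCompact (G : Set (absoluteGaloisGroup F)))
    (O : Subgroup (absoluteGaloisGroup F)) (hO : IsOpen (O : Set (absoluteGaloisGroup F)))
    [Fintype (G ⧸ O.subgroupOf G)] (hI : G ⊓ absInertia F ≤ O) :
    ∃ x : AlgebraicClosure F, algNorm F x ≤ 1 ∧ (∀ u ∈ O ⊓ G, u • x = x) ∧
      (∑ q : G ⧸ O.subgroupOf G, ((q.out : G) : absoluteGaloisGroup F) • x) = 1 := by
  classical
  obtain ⟨N, hNu, hsep⟩ := exists_isUnit_forall_smul_eq_imp_mem G hGc O hO hI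
  have hN0 : N ≠ 0 := by rintro rfl; simp at hNu
  haveI : NeZero ((N : ℕ) : AlgebraicClosure F) := ⟨natCast_algebraicClosure_ne_zero_of_isUnit hNu⟩
  obtain ⟨ζ, hζ⟩ := HasEnoughRootsOfUnity.exists_primitiveRoot (AlgebraicClosure F) N
  -- `H = Stab_G(ζ) ≤ K = G ∩ O`
  have hHK : MulAction.stabilizer G ζ ≤ O.subgroupOf G := by
    intro h hh
    rw [Subgroup.mem_subgroupOf]
    exact hsep _ h.2 fun ξ hξ ↦ smul_eq_self_of_mem_stabilizer_of_pow_eq_one G hN0 hζ hh hξ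
  haveI : Finite (G ⧸ MulAction.stabilizer G ζ) := finite_quotient_stabilizer_of_isPrimitiveRoot G hN0 hζ
  letI : Fintype (G ⧸ MulAction.stabilizer G ζ) := Fintype.ofFinite _
  haveI : Finite ((G ⧸ O.subgroupOf G) ×
      (O.subgroupOf G ⧸ (MulAction.stabilizer G ζ).subgroupOf (O.subgroupOf G))) :=
    Finite.of_equiv _ (Subgroup.quotientEquivProdOfLE hHK)
  haveI : Finite (O.subgroupOf G ⧸ (MulAction.stabilizer G ζ).subgroupOf (O.subgroupOf G)) :=
    Finite.of_injective (Prod.mk ((1 : G) : G ⧸ O.subgroupOf G)) (Prod.mk_right_injective _)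
  letI : Fintype (O.subgroupOf G ⧸ (MulAction.stabilizer G ζ).subgroupOf (O.subgroupOf G)) :=
    Fintype.ofFinite _
  obtain ⟨x₀, hx₀, hx₀H, hx₀sum⟩ := exists_sum_smul_eq_one_stabilizer G hNu hζ
  obtain ⟨x, hx, hxK, hxsum⟩ := exists_sum_smul_eq_one_of_le G hHK hx₀.le hx₀H hx₀sum
  refine ⟨x, hx, fun u hu ↦ ?_, hxsum⟩
  have huK : (⟨u, hu.2⟩ : G) ∈ O.subgroupOf G := by rw [Subgroup.mem_subgroupOf]; exact hu.1
  exact hxK ⟨u, hu.2⟩ huK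

end Literature.NumberTheory.GaloisRepresentations

end
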